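import Mathlib
import HarnessLib
import Summits.Ventures.LatticeQCDFlow.Exactness.NCMCGeneralSpaceReplicaProductChainTStatistic
import Summits.Ventures.LatticeQCDFlow.Exactness.NCMCGeneralSpaceIndicatorCLT
import Summits.Ventures.LatticeQCDFlow.Exactness.NCMCGeneralSpaceEventTauIntPositive

/-!
# Event frequencies over streams with a DEPENDENT joint start (the product chain): the replica-`t` / jackknife bar has limiting coverage `L_R(q)` UNCONDITIONALLY

HONEST FRAMING: exact (Metropolis-corrected) sampling algorithms for lattice gauge theory;
figures of merit are autocorrelation/cost numbers at stated couplings and volumes; no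
continuum-physics claim.

Venture `LatticeQCDFlow` (cell pub-lqcd), topic `Exactness`; FANOUT row 13 (`eng-snf`, GEN-26).
NEW WORK of the cell: the dependent-start companion of GEN-24 `NCMCGeneralSpaceReplicaOccupancyJackknife`
§1 (independent chains).  Composition of GEN-24 D3 `NCMCGeneralSpaceReplicaProductChainTStatistic`
(`tendsto_measure_abs_replicaTStat_le_productChain`: the replica-`t` bar of the product chain
`replicaSweep (fun _ ↦ κ)` has coverage `→ L_R(q)` from EVERY joint initial law when `σ²_f > 0`),
GEN-19 `greenKubo_indicator_eq_tauInt` (the Green–Kubo variance of an indicator is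
`2 τ_int(ρ_A) π(A)(1 − π(A))`) and GEN-21 `tauInt_setACF_pos_of_nHit` (`τ_int(ρ_A) > 0` for every event
with `0 < π(A) < 1`).  Not a published result; no definition; nothing cited as a fact.

WHY (row 13).  Acceptance rates, level occupancies and indicator diagnostics are reported with the
replica-`t` (= delete-one-stream jackknife, GEN-24 JK) bar over the `R` streams of a run; the streams
are commonly BRANCHED OFF ONE equilibration run (dependent joint start) and then advanced independently
— the product chain.  For event frequencies the variance hypothesis of D3 is automatic, so: `κ` Markov
with invariant `π` and the one-step minorisation `ε ν ≤ κ(z, ·)` (`ε ≠ 0`), `A` measurable with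
`0 < π(A) < 1`, `R = card ι ≥ 2` streams from ANY joint law `μ`, `q ≥ 0` ⇒
`P(|((1/R)Σ_r p̂_{r,n} − π(A))/√(Σ_r (p̂_{r,n} − p̄̂_n)²/(R(R−1)))| ≤ q) → L_R(q) = N(0,1)^{⊗R}{|t| ≤ q}`.

* `greenKubo_autocov_indicator_pos` — `0 < C_{1_A − π(A)}(0) + 2 Σ_{k≥1} C_{1_A − π(A)}(k)` (autocov form).
* **`tendsto_measure_abs_indicatorReplicaT_le_productChain`**.

NOT CLAIMED: a Doeblin POWER instead of the one-step minorisation (so the two-step NCMC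
expanded-ensemble certificate of `…OccupancyJackknife` §2 is not covered here); interacting streams;
anything numerical.
-/

namespace Summit.Ventures.LatticeQCDFlow.Exactness.GeneralNCMC

open MeasureTheory ProbabilityTheory Set Filter Finset Function WithLp
open Summit.Ventures.LatticeQCDFlow.Exactness
open scoped ENNReal NNReal Topology

variable {ι : Type*} [DecidableEq ι] [Fintype ι] [Nontrivial ι] {S : Type*} [MeasurableSpace S]
  {κ : Kernel S S} [IsMarkovKernel κ] {π : Measure S} [IsProbabilityMeasure π]
  {ν : Measure S} [IsProbabilityMeasure ν] {ε : ℝ≥0∞}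

omit [DecidableEq ι] [Fintype ι] [Nontrivial ι] in
/-- **The Green–Kubo variance of a non-trivial event is positive** (autocovariance form): one-step
minorised `κ` with invariant `π`, `0 < π(A) < 1`. -/
theorem greenKubo_autocov_indicator_pos (hπ : Kernel.Invariant κ π) (hε : ε ≠ 0)
    (hmin : ∀ z, ε • ν ≤ κ z) {A : Set S} (hA : MeasurableSet A) (h0 : 0 < π.real A)
    (h1 : π.real A < 1) :
    0 < Scoring.autocov κ π (fun y => A.indicator (1 : S → ℝ) y - ∫ z, A.indicator (1 : S → ℝ) z ∂π) 0
      + 2 * ∑' k, Scoring.autocov κ π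
        (fun y => A.indicator (1 : S → ℝ) y - ∫ z, A.indicator (1 : S → ℝ) z ∂π) (k + 1) := by
  have hmin' : ∀ z, ε • ν ≤ nHit κ 1 z := fun z => by rw [nHit_one]; exact hmin z
  have hτ := tauInt_setACF_pos_of_nHit hπ hε hmin' Nat.one_pos hA h0 h1
  have hp : 0 < π.real A * (1 - π.real A) := mul_pos h0 (sub_pos.2 h1)
  have key := greenKubo_indicator_eq_tauInt hπ hA h0 h1
  have heq : Scoring.autocov κ π
        (fun y => A.indicator (1 : S → ℝ) y - ∫ z, A.indicator (1 : S → ℝ) z ∂π) 0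
      + 2 * ∑' k, Scoring.autocov κ π
        (fun y => A.indicator (1 : S → ℝ) y - ∫ z, A.indicator (1 : S → ℝ) z ∂π) (k + 1)
      = 2 * Scoring.tauInt (setACF κ π A) * (π.real A * (1 - π.real A)) := by
    rw [← key]
    unfold Scoring.autocov
    simp only [Function.iterate_zero, id_eq, sq]
  rw [heq]
  positivity

/-- **THE REPLICA-`t` BAR OF AN EVENT FREQUENCY OVER STREAMS WITH A DEPENDENT JOINT START HAS LIMITING
COVERAGE `L_R(q)`, UNCONDITIONALLY.**  `κ` Markov, `π` invariant, `ε ν ≤ κ(z, ·)` for all `z`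
(`ε ≠ 0`); `L` a duplicate-free list through all of `ι` (`R = card ι ≥ 2` streams, each advanced by its
own draw from `κ`); `A` measurable with `0 < π(A) < 1`; `μ` ANY joint law of the initial states; `q ≥ 0`.
With `p̂_{r,n}` the frequency of `A` along stream `r`:
`P(|((1/R)Σ_r p̂_{r,n} − π(A))/√(Σ_r (p̂_{r,n} − p̄̂_n)²/(R(R−1)))| ≤ q) → N(0,1)^{⊗R}{|t| ≤ q}`. -/
theorem tendsto_measure_abs_indicatorReplicaT_le_productChain (hπ : Kernel.Invariant κ π)
    (hε : ε ≠ 0) (hmin : ∀ z, ε • ν ≤ κ z) {L : List ι} (hL : L.Nodup) (hLall : ∀ r, r ∈ L)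
    {A : Set S} (hA : MeasurableSet A) (h0 : 0 < π.real A) (h1 : π.real A < 1)
    (μ : Measure (ι → S)) [IsProbabilityMeasure μ]
    [IsProbabilityMeasure (Kernel.trajMeasure (X := fun _ : ℕ => ι → S) μ
        (fun n : ℕ => (replicaSweep (fun _ : ι => κ) L).comap
          (fun hh : (i : ↥(Finset.Iic n)) → ι → S => hh ⟨n, Finset.mem_Iic.2 le_rfl⟩)
          (measurable_pi_apply _)))] {q : ℝ} (hq : 0 ≤ q) :
    Tendsto (fun n : ℕ => (Kernel.trajMeasure (X := fun _ : ℕ => ι → S) μ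
        (fun n : ℕ => (replicaSweep (fun _ : ι => κ) L).comap
          (fun hh : (i : ↥(Finset.Iic n)) → ι → S => hh ⟨n, Finset.mem_Iic.2 le_rfl⟩)
          (measurable_pi_apply _)))
        {x : ℕ → ι → S |
          |((∑ r, (∑ t ∈ range n, A.indicator (1 : S → ℝ) (x t r)) / n) / Fintype.card ι - π.real A)
            / Real.sqrt ((∑ r, ((∑ t ∈ range n, A.indicator (1 : S → ℝ) (x t r)) / n
                - (∑ r', (∑ t ∈ range n, A.indicator (1 : S → ℝ) (x t r')) / n)
                  / Fintype.card ι) ^ 2)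
              / ((Fintype.card ι : ℝ) * (Fintype.card ι - 1)))| ≤ q})
      atTop
      (𝓝 ((Measure.pi fun _ : ι => gaussianReal 0 1) {z : ι → ℝ | |(∑ r, z r) / Fintype.card ι
        / Real.sqrt ((∑ r, (z r - (∑ r', z r') / Fintype.card ι) ^ 2)
            / ((Fintype.card ι : ℝ) * (Fintype.card ι - 1)))| ≤ q})) := by
  have hC : ∀ y, |A.indicator (1 : S → ℝ) y| ≤ 1 := fun y => by
    by_cases hy : y ∈ A <;> simp [Set.indicator, hy]
  have h := tendsto_measure_abs_replicaTStat_le_productChain hπ hε hmin hL hLall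
    (f := A.indicator (1 : S → ℝ)) (measurable_one.indicator hA) hC
    (greenKubo_autocov_indicator_pos hπ hε hmin hA h0 h1) μ hq
  rw [integral_indicator_one hA] at h
  exact h

end Summit.Ventures.LatticeQCDFlow.Exactness.GeneralNCMC
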